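import Summits.ABC.ABC.Theorems.EisensteinQuarantine.Negative.EisensteinQuarantineFalseOfForcedPairDegreeDepthLaw
import Summits.ABC.ABC.Theorems.DefiniteXiEisensteinQuarantineForcedPairOccurrence
import Literature.NumberTheory.EllipticCurves.NewformsOrthogonalProofs
import Literature.NumberTheory.EllipticCurves.CongruenceNumber
import Literature.NumberTheory.EllipticCurves.ModularSymbolsLattice
import HarnessLib

/-!
# Stub-critic scratch (stmt-ABC-15023, `stub_forcedPairOccurrence`): research tier R-A typed.
S1 is PROVED (term over landed tree lemmas); the R-A core and its adapter are statements
(A4 proved too).  Not a proposal.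
-/

set_option linter.dupNamespace false

noncomputable section

open scoped BigOperators MatrixGroups ModularForm
open CongruenceSubgroup
open Literature.NumberTheory.Automorphic Literature.NumberTheory.EllipticCurves
open Literature.NumberTheory.EllipticCurves.ModularForms
open Summit.ABC.ABC.Theorems.EisensteinQuarantine.Negative Summit.ABC.ABC.Theorems

namespace Summit.ABC.ABC.Cruxes.EisensteinQuarantine.ForcedPairDlog.StubPlan

/-- **S1** (PROVED): a `q`-expansion congruence `f ≡ g (mod r)` between a NEW form `f ≠ 0` and an
integral OLD form `g` forces `r ∣ r_f` — `new ⊥ old` (`newSubspace0_le_orthogonal_oldSubspace0`,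
landed) feeds ARS (i) ⇒ (ii) (`dvd_congruenceNumber_of_sub_eq_smul`, landed). -/
theorem dvd_congruenceNumber_of_oldform_congruence {N : ℕ} [NeZero N]
    {f g h : CuspForm (Gamma0 N) 2} (hf : f ∈ newSubspace0 N 2) (hf0 : f ≠ 0)
    (hg : g ∈ oldSubspace0 N 2) (hgi : g ∈ integralCuspForms0 N 2)
    (hh : h ∈ integralCuspForms0 N 2) {r : ℕ} (hfg : f - g = r • h) :
    r ∣ congruenceNumber f :=
  dvd_congruenceNumber_of_sub_eq_smul hf0
    (mem_integralOrthogonal0.mpr ⟨hgi, newSubspace0_le_orthogonal_oldSubspace0 N 2 hf g hg⟩) hh hfg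

/-- k2's A3-core, verbatim (local copy; the Cruxes module is not importable). -/
def ForcedPairCongruenceDepthLaw : Prop :=
  ∃ c : ℕ, ∀ q ℓ : ℕ, q.Prime → ℓ.Prime → q ≠ 2 → 32 * q ∣ ℓ - 1 →
    ∀ (N : ℕ) [NeZero N], (freyCurve (-(ℓ : ℤ)) ((ℓ - 1 : ℕ) : ℤ)).conductorNorm ℤ = N →
    ∀ (W : WeierstrassCurve ℚ) [W.IsElliptic] (P : ModularParametrizationData W N),
      (∀ n : ℕ, W.LFunction n = (freyCurve (-(ℓ : ℤ)) ((ℓ - 1 : ℕ) : ℤ)).LFunction n) →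
      (∀ (W' : WeierstrassCurve ℚ) [W'.IsElliptic] (P' : ModularParametrizationData W' N),
          P'.f = P.f → P.modularDegree ≤ P'.modularDegree) →
      2 ^ ((q - 1).factorization 2) * ordProj[2] ((W.minimalDiscriminantNorm ℤ).factorization ℓ) ≤
        2 ^ c * ordProj[2] (congruenceNumber P.f)

/-- **R-A core `ForcedPairOldLatticeProximity`** (RESEARCH; the EXHIBIT form of the congruence-number
currency): at every forced pair the Frey newform is congruent, modulo `2^{v₂(q−1)+v₂(c_ℓ(W))−c}`, to an
integral OLD form of level `N`.  Strictly stronger than `ForcedPairCongruenceDepthLaw` (given `r_f > 0`). -/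
def ForcedPairOldLatticeProximity : Prop :=
  ∃ c : ℕ, ∀ q ℓ : ℕ, q.Prime → ℓ.Prime → q ≠ 2 → 32 * q ∣ ℓ - 1 →
    ∀ (N : ℕ) [NeZero N], (freyCurve (-(ℓ : ℤ)) ((ℓ - 1 : ℕ) : ℤ)).conductorNorm ℤ = N →
    ∀ (W : WeierstrassCurve ℚ) [W.IsElliptic] (P : ModularParametrizationData W N),
      (∀ n : ℕ, W.LFunction n = (freyCurve (-(ℓ : ℤ)) ((ℓ - 1 : ℕ) : ℤ)).LFunction n) →
      ∃ g h : CuspForm (Gamma0 N) 2,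
        g ∈ oldSubspace0 N 2 ∧ g ∈ integralCuspForms0 N 2 ∧ h ∈ integralCuspForms0 N 2 ∧
        P.f - g = (2 ^ ((q - 1).factorization 2
                    + (((W.minimalDiscriminantNorm ℤ).factorization ℓ).factorization 2) - c) : ℕ) • h

/-- Positivity of the congruence number of the newform of an elliptic curve (ARS 2012 §2.1 "the positive
integer `r_E`"; in the tree only as a hypothesis, cf. `SameLevelCongruenceFacts` (b)). -/
def CongruenceNumberPos : Prop :=
  ∀ (W : WeierstrassCurve ℚ) [W.IsElliptic] (N : ℕ) [NeZero N] (D : ModularParametrizationData W N),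
    0 < congruenceNumber D.f

/-- **A4** (ONE CYCLE, arithmetic of `ordProj` + S1 + `P.isNewformOf.1.1 : P.f ∈ newSubspace0 N 2`):
the exhibit form gives the congruence-number law. -/
theorem congruenceDepthLaw_of_oldLatticeProximity (hpos : CongruenceNumberPos)
    (h : ForcedPairOldLatticeProximity) : ForcedPairCongruenceDepthLaw := by
  obtain ⟨c, hc⟩ := h
  refine ⟨c, fun q ℓ hq hℓ hq2 h32 N _ hN W _ P hLf _ => ?_⟩
  obtain ⟨g, h, hg, hgi, hh, hfg⟩ := hc q ℓ hq hℓ hq2 h32 N hN W P hLf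
  have hr : 0 < congruenceNumber P.f := hpos W N P
  have hdvd : 2 ^ ((q - 1).factorization 2
      + (((W.minimalDiscriminantNorm ℤ).factorization ℓ).factorization 2) - c) ∣ congruenceNumber P.f :=
    dvd_congruenceNumber_of_oldform_congruence P.isNewformOf.1.1 (IsNewform0.ne_zero P.isNewformOf.1)
      hg hgi hh hfg
  have hle : (q - 1).factorization 2
      + ((W.minimalDiscriminantNorm ℤ).factorization ℓ).factorization 2 - c
        ≤ (congruenceNumber P.f).factorization 2 :=
    (Nat.prime_two.pow_dvd_iff_le_factorization hr.ne').mp hdvd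
  calc 2 ^ (q - 1).factorization 2 * ordProj[2] ((W.minimalDiscriminantNorm ℤ).factorization ℓ)
      = 2 ^ ((q - 1).factorization 2
          + ((W.minimalDiscriminantNorm ℤ).factorization ℓ).factorization 2) := by rw [pow_add]
    _ ≤ 2 ^ (c + (congruenceNumber P.f).factorization 2) :=
        Nat.pow_le_pow_right (by norm_num) (by omega)
    _ = 2 ^ c * ordProj[2] (congruenceNumber P.f) := by rw [pow_add]

/-- Sanity: the newform of a parametrisation datum is new and nonzero-normalised data is available. -/
example {N : ℕ} [NeZero N] {W : WeierstrassCurve ℚ} (P : ModularParametrizationData W N) :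
    P.f ∈ newSubspace0 N 2 := P.isNewformOf.1.1

end Summit.ABC.ABC.Cruxes.EisensteinQuarantine.ForcedPairDlog.StubPlan

end
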